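import Summits.QuantumFields.BalabanUV.Beta.GAN24.ClosedFormBoundOfParts
import Summits.QuantumFields.BalabanUV.Beta.GAN24.AliasReindex

/-!
# `BalabanUV.Beta.GAN24.ClosedFormRateOfParts` — binder row G-an2-4 / (CONV-C), road P1-fibre, typer row **P1-Y11d** (node N17d of
# `GAN24/Formal/LEAVES.md` v2.2), part 2 of 2: row L11's BOOKKEEPING HALF AS A FUNCTION — the one-step difference of the closed-form
# fibre function is bounded by matched-label rates plus the new-label tail (items (ii), (iii) of the row)

NOT IN PRINT; OUR PROOF ATTEMPT.  HONEST FRAMING (cell contract, verbatim): «discharging `BetaPertH` makes Bałaban's UV stability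
UNCONDITIONAL — a real constructive-QFT result; it is NOT the continuum limit and NOT the Clay problem.»  HONEST DEPENDENCY (verbatim):
«continuum YM on T⁴ ⇐ BetaPertH ∧ nine spine estimates (0/9 proved); BetaPertH ⇐ (D1) ∧ (D4) ∧ CAP+tail; G-an2-4 gates asym, D1 and
NE2/3/4.»  [folklore] finite-sum norm algebra over the DEFINITIONS of typer row T00 `GAN24/AliasObjects` (p201364: `kFibClosed`,
`kFibClosedW`, `readW`, `Ahat`, `phiSol`, `fhatF`, `eVec`), the leg unfoldings of row Y09d `GAN24/ClosedFormBoundOfParts` (p201825) and the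
re-indexing of part 1 `GAN24/AliasReindex` — all BY NAME, nothing redefined; NO estimate of any alias sum, NO cited fact, NO `def … : Prop`
hypothesis, NO wall binder, NO unit sequence re-typed (TRIGGER-P1 c1–c3: `s_f, s_m : ℕ → ℝ` stay OPAQUE; nothing of `Lc^j` or `θ` is
recognised here).  NOT summit progress; nothing of (CONV-C)'s K-slot is discharged here.

## What is proved (row text of `HOME/GAN24/Formal/LEAVES.md` v2.2, P1-Y11d (ii)(iii), transcribed)
Level `j` of the step function is `kFibClosed Lc s_f s_m j = kFibClosedW (Lc^{j+1}) (Lc^j) (s_f j) (s_m j)`, level `j+1` is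
`kFibClosedW (Lc^{j+2}) (Lc^{j+1}) (s_f (j+1)) (s_m (j+1))` (T00, `rfl`).
* §1 PRODUCT TELESCOPING over `ℂ` (item (ii)): `‖a′b′ − ab‖ ≤ ‖a′ − a‖‖b′‖ + ‖a‖‖b′ − b‖`, the 3- and 4-factor forms, and the forms with
  uniform factor bounds (`…_of_bounds`);
* §2 LEVEL-INDEPENDENCE OF THE MULTIPLIER-LEG PHASES (B1 «pure phases that cancel», kernel form): `quo (Lc^{j+1}) (Lc^j • x′) = quo Lc x′`
  (`quo_step`), so the Bloch phases `e^{±ip·quo}` of the fm/mf/mm legs are THE SAME complex number at every level (`cphase_*_step`);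
* §3 THE FOUR LEG DIFFERENCES, every complex `p`: `kFibClosed_succ_sub_ff/fm/mf/mm` (unfoldings), and the PLUG FORMS (item (iii))
  `norm_kFibClosed_succ_sub_ff_le` / `_fm_le`: matched-label rates `‖s′² F′(lift m) − s² F(m)‖ ≤ ρ m` (rows Y11r/Y11s/N13/`SymbolRate` supply
  them) + a new-label TAIL `Σ_{m′ ∈ newLabels} ‖s′² F′ m′‖ ≤ τ` (row E3 `GAN24/AliasTail`, `AliasWeightsSum.alias_tail_sum_le`) ⇒
  `‖Δ‖ ≤ (Σ_m ρ m + τ)·‖phase‖`; the FACTORISED forms `…_of_factors` (reading weight | unit-scaled response, via §1);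
  `norm_kFibClosed_succ_sub_mf_le` / `_mm_le`: a rate of the unit-scaled multiplier response `‖s′ φ′_κ − s φ_κ‖ ≤ ρ` ⇒ `‖Δ‖ ≤ ‖phase‖·ρ`;
  real zone `p = ofRealVec q`: the phases are unimodular (`FibreStepResidues.norm_cphase_ofRealVec` BY NAME), `…_real`;
* §4 UNIFORM PLUG FORM over the four leg types at real momentum: `‖kFibClosed … (j+1) … − kFibClosed … j …‖ ≤ C_ff + C_fm + C_mf + C_mm`.
Consumers: p1 row L11 `FibreRate` (recognises `c·θ^j`, transfers to `kFib` by L05b `FibInvClosedForm` at both levels, `p = 0` by Y09c).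
-/

noncomputable section

open Complex Finset
open scoped BigOperators
open Literature.Probability.LatticeModels (TorusSite)
open Literature.MathematicalPhysics.QuantumFieldTheory
open Literature.MathematicalPhysics.QuantumFieldTheory.LatticeForm (quo)
open Literature.MathematicalPhysics.QuantumFieldTheory.Balaban1983to89
open Literature.MathematicalPhysics.QuantumFieldTheory.Balaban1983to89.Beta
open B4Strip (ofRealVec)
open FibreInverseDecay (cphase)
open OneStepResolventKernel (Fib)
open Summit.QuantumFields.BalabanUV.Beta.GAN24.AliasObjects (kFibClosedW kFibClosed readW Ahat phiSol fhatF eVec)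
open Summit.QuantumFields.BalabanUV.Beta.GAN24.FibreStepResidues (norm_cphase_ofRealVec)
open Summit.QuantumFields.BalabanUV.Beta.GAN24.AliasReindex (lift newLabels norm_mul_sum_sub_mul_sum_le_of_rates)

namespace Summit.QuantumFields.BalabanUV.Beta.GAN24.ClosedFormRateOfParts

variable {d : ℕ}

/-! ## §1 Product telescoping -/

/-- [folklore] TWO FACTORS: `‖a′b′ − ab‖ ≤ ‖a′ − a‖·‖b′‖ + ‖a‖·‖b′ − b‖`. -/
theorem norm_mul_sub_mul_le (a a' b b' : ℂ) : ‖a' * b' - a * b‖ ≤ ‖a' - a‖ * ‖b'‖ + ‖a‖ * ‖b' - b‖ := by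
  have e : a' * b' - a * b = (a' - a) * b' + a * (b' - b) := by ring
  rw [e]
  exact (norm_add_le _ _).trans (by rw [norm_mul, norm_mul])

/-- [folklore] THREE FACTORS: `‖a′b′c′ − abc‖ ≤ ‖a′ − a‖‖b′‖‖c′‖ + ‖a‖‖b′ − b‖‖c′‖ + ‖a‖‖b‖‖c′ − c‖`. -/
theorem norm_mul3_sub_mul3_le (a a' b b' c c' : ℂ) :
    ‖a' * b' * c' - a * b * c‖ ≤ ‖a' - a‖ * ‖b'‖ * ‖c'‖ + ‖a‖ * ‖b' - b‖ * ‖c'‖ + ‖a‖ * ‖b‖ * ‖c' - c‖ := by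
  have e : a' * b' * c' - a * b * c = (a' - a) * b' * c' + a * (b' - b) * c' + a * b * (c' - c) := by ring
  rw [e]
  refine (norm_add₃_le).trans ?_
  rw [norm_mul, norm_mul, norm_mul, norm_mul, norm_mul, norm_mul]

/-- [folklore] FOUR FACTORS. -/
theorem norm_mul4_sub_mul4_le (a a' b b' c c' e e' : ℂ) :
    ‖a' * b' * c' * e' - a * b * c * e‖ ≤ ‖a' - a‖ * ‖b'‖ * ‖c'‖ * ‖e'‖ + ‖a‖ * ‖b' - b‖ * ‖c'‖ * ‖e'‖ +
      ‖a‖ * ‖b‖ * ‖c' - c‖ * ‖e'‖ + ‖a‖ * ‖b‖ * ‖c‖ * ‖e' - e‖ := by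
  have h1 := norm_mul_sub_mul_le (a * b * c) (a' * b' * c') e e'
  have h2 := norm_mul3_sub_mul3_le a a' b b' c c'
  have h3 : ‖a' * b' * c' - a * b * c‖ * ‖e'‖ ≤
      (‖a' - a‖ * ‖b'‖ * ‖c'‖ + ‖a‖ * ‖b' - b‖ * ‖c'‖ + ‖a‖ * ‖b‖ * ‖c' - c‖) * ‖e'‖ :=
    mul_le_mul_of_nonneg_right h2 (norm_nonneg _)
  rw [norm_mul, norm_mul] at h1
  nlinarith [h1, h3, norm_nonneg a, norm_nonneg b, norm_nonneg c, norm_nonneg e', norm_nonneg (e' - e)]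

/-- [folklore] TWO FACTORS WITH BOUNDS: `‖a‖ ≤ A`, `‖b′‖ ≤ B′`, `‖a′ − a‖ ≤ ρ_a`, `‖b′ − b‖ ≤ ρ_b` ⇒ `‖a′b′ − ab‖ ≤ ρ_a B′ + A ρ_b`. -/
theorem norm_mul_sub_mul_le_of_bounds {a a' b b' : ℂ} {A B' ρa ρb : ℝ} (ha : ‖a‖ ≤ A) (hb' : ‖b'‖ ≤ B')
    (hρa : ‖a' - a‖ ≤ ρa) (hρb : ‖b' - b‖ ≤ ρb) : ‖a' * b' - a * b‖ ≤ ρa * B' + A * ρb :=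
  (norm_mul_sub_mul_le a a' b b').trans (add_le_add (mul_le_mul hρa hb' (norm_nonneg _) ((norm_nonneg _).trans hρa))
    (mul_le_mul ha hρb (norm_nonneg _) ((norm_nonneg _).trans ha)))

/-- [folklore] THREE FACTORS WITH BOUNDS: `≤ ρ_a B′ C′ + A ρ_b C′ + A B ρ_c`. -/
theorem norm_mul3_sub_mul3_le_of_bounds {a a' b b' c c' : ℂ} {A B B' C' ρa ρb ρc : ℝ} (ha : ‖a‖ ≤ A) (hb : ‖b‖ ≤ B)
    (hb' : ‖b'‖ ≤ B') (hc' : ‖c'‖ ≤ C') (hρa : ‖a' - a‖ ≤ ρa) (hρb : ‖b' - b‖ ≤ ρb) (hρc : ‖c' - c‖ ≤ ρc) :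
    ‖a' * b' * c' - a * b * c‖ ≤ ρa * B' * C' + A * ρb * C' + A * B * ρc := by
  refine (norm_mul3_sub_mul3_le a a' b b' c c').trans (add_le_add (add_le_add ?_ ?_) ?_)
  · exact mul_le_mul (mul_le_mul hρa hb' (norm_nonneg _) ((norm_nonneg _).trans hρa)) hc' (norm_nonneg _)
      (mul_nonneg ((norm_nonneg _).trans hρa) ((norm_nonneg _).trans hb'))
  · exact mul_le_mul (mul_le_mul ha hρb (norm_nonneg _) ((norm_nonneg _).trans ha)) hc' (norm_nonneg _)
      (mul_nonneg ((norm_nonneg _).trans ha) ((norm_nonneg _).trans hρb))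
  · exact mul_le_mul (mul_le_mul ha hb (norm_nonneg _) ((norm_nonneg _).trans ha)) hρc (norm_nonneg _)
      (mul_nonneg ((norm_nonneg _).trans ha) ((norm_nonneg _).trans hb))

/-- [folklore] TWO FACTORS WITH A SCALAR PREFACTOR carried by the second factor (the unit factor rides with the response):
`‖c′(R′A′) − c(RA)‖ ≤ ρ_R·β_A + β_R·ρ_A` from `‖R‖ ≤ β_R`, `‖c′A′‖ ≤ β_A`, `‖R′ − R‖ ≤ ρ_R`, `‖c′A′ − cA‖ ≤ ρ_A`. -/
theorem norm_smul_mul_sub_le_of_bounds {c c' R R' A A' : ℂ} {βR βA ρR ρA : ℝ} (hβR : ‖R‖ ≤ βR) (hβA : ‖c' * A'‖ ≤ βA)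
    (hR : ‖R' - R‖ ≤ ρR) (hA : ‖c' * A' - c * A‖ ≤ ρA) : ‖c' * (R' * A') - c * (R * A)‖ ≤ ρR * βA + βR * ρA := by
  have e : c' * (R' * A') - c * (R * A) = R' * (c' * A') - R * (c * A) := by ring
  rw [e]
  exact norm_mul_sub_mul_le_of_bounds hβR hβA hR hA

/-! ## §2 The multiplier-leg phases do not see the level -/

section Phase

variable (Lc : ℕ) [NeZero Lc]

/-- [folklore] **`quo (Lc^{j+1}) (Lc^j • x′) = quo Lc x′`**: the `Lc^{j+1}`-block index of the `Lc^j`-scaled coarse point is its `Lc`-block index —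
the same at every level `j` (Euclidean division: `(Lc^j·x)/(Lc^j·Lc) = x/Lc`). -/
theorem quo_step (j : ℕ) (x' : Fin (d + 1) → ℤ) : quo (Lc ^ (j + 1)) (((Lc ^ j : ℕ) : ℤ) • x') = quo Lc x' := by
  funext i
  have hpos : (0 : ℤ) < (Lc : ℤ) ^ j := pow_pos (by exact_mod_cast Nat.pos_of_ne_zero (NeZero.ne Lc)) j
  simp only [quo, Pi.smul_apply, smul_eq_mul]
  push_cast
  rw [pow_succ, Int.mul_ediv_mul_of_pos _ _ hpos]

/-- [folklore] The difference of two block indices is level-free as well. -/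
theorem quo_step_sub (j : ℕ) (x' y' : Fin (d + 1) → ℤ) :
    quo (Lc ^ (j + 1)) (((Lc ^ j : ℕ) : ℤ) • x') - quo (Lc ^ (j + 1)) (((Lc ^ j : ℕ) : ℤ) • y') = quo Lc x' - quo Lc y' := by
  rw [quo_step, quo_step]

/-- [folklore] The mf phase at level `j` is `e^{ip·quo Lc x′}`. -/
theorem cphase_mf_step (j : ℕ) (x' : Fin (d + 1) → ℤ) (p : Fin (d + 1) → ℂ) :
    cphase (quo (Lc ^ (j + 1)) (((Lc ^ j : ℕ) : ℤ) • x')) p = cphase (quo Lc x') p := by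
  rw [quo_step]

/-- [folklore] The fm phase at level `j` is `e^{−ip·quo Lc y′}`. -/
theorem cphase_fm_step (j : ℕ) (y' : Fin (d + 1) → ℤ) (p : Fin (d + 1) → ℂ) :
    cphase (-quo (Lc ^ (j + 1)) (((Lc ^ j : ℕ) : ℤ) • y')) p = cphase (-quo Lc y') p := by
  rw [quo_step]

/-- [folklore] The mm phase at level `j` is `e^{ip·(quo Lc x′ − quo Lc y′)}`. -/
theorem cphase_mm_step (j : ℕ) (x' y' : Fin (d + 1) → ℤ) (p : Fin (d + 1) → ℂ) :
    cphase (quo (Lc ^ (j + 1)) (((Lc ^ j : ℕ) : ℤ) • x') - quo (Lc ^ (j + 1)) (((Lc ^ j : ℕ) : ℤ) • y')) p =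
      cphase (quo Lc x' - quo Lc y') p := by
  rw [quo_step_sub]

end Phase

/-! ## §3 The four leg differences and their plug forms -/

section Legs

variable (Lc : ℕ) [NeZero Lc] (sf sm : ℕ → ℝ) (j : ℕ)

/-- [folklore] `Lc^{j+1} ≤ Lc^{j+2}` (`Lc ≥ 1`): the level-`j` box embeds in the level-`(j+1)` box. -/
theorem pow_step_le : Lc ^ (j + 1) ≤ Lc ^ (j + 2) :=
  Nat.pow_le_pow_right (Nat.pos_of_ne_zero (NeZero.ne Lc)) (by omega)

/-- [folklore] **ff DIFFERENCE** (unfolding, every complex `p`). -/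
theorem kFibClosed_succ_sub_ff (κ l : Fin (d + 1)) (x' y' : Fin (d + 1) → ℤ) (p : Fin (d + 1) → ℂ) :
    kFibClosed Lc sf sm (j + 1) (Sum.inl κ) x' (Sum.inl l) y' p - kFibClosed Lc sf sm j (Sum.inl κ) x' (Sum.inl l) y' p =
      ((sf (j + 1) * sf (j + 1) : ℝ) : ℂ) * ∑ m', readW (Lc ^ (j + 2)) (Lc ^ (j + 1)) p m' κ x' *
          Ahat (Lc ^ (j + 2)) p (fhatF (Lc ^ (j + 2)) (Lc ^ (j + 1)) p l y') 0 m' κ -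
      ((sf j * sf j : ℝ) : ℂ) * ∑ m, readW (Lc ^ (j + 1)) (Lc ^ j) p m κ x' *
          Ahat (Lc ^ (j + 1)) p (fhatF (Lc ^ (j + 1)) (Lc ^ j) p l y') 0 m κ := rfl

/-- [folklore] **fm DIFFERENCE**: the common phase `e^{−ip·quo Lc y′}` factors out (§2). -/
theorem kFibClosed_succ_sub_fm (κ l : Fin (d + 1)) (x' y' : Fin (d + 1) → ℤ) (p : Fin (d + 1) → ℂ) :
    kFibClosed Lc sf sm (j + 1) (Sum.inl κ) x' (Sum.inr l) y' p - kFibClosed Lc sf sm j (Sum.inl κ) x' (Sum.inr l) y' p =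
      cphase (-quo Lc y') p *
        (((sf (j + 1) * sm (j + 1) : ℝ) : ℂ) * ∑ m', readW (Lc ^ (j + 2)) (Lc ^ (j + 1)) p m' κ x' * Ahat (Lc ^ (j + 2)) p 0 (eVec l) m' κ -
          ((sf j * sm j : ℝ) : ℂ) * ∑ m, readW (Lc ^ (j + 1)) (Lc ^ j) p m κ x' * Ahat (Lc ^ (j + 1)) p 0 (eVec l) m κ) := by
  show kFibClosedW _ _ _ _ _ _ _ _ p - kFibClosedW _ _ _ _ _ _ _ _ p = _
  rw [ClosedFormBoundOfParts.kFibClosedW_fm, ClosedFormBoundOfParts.kFibClosedW_fm, cphase_fm_step Lc (j + 1), cphase_fm_step Lc j]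
  ring

/-- [folklore] **mf DIFFERENCE**: the common phase `e^{ip·quo Lc x′}` factors out. -/
theorem kFibClosed_succ_sub_mf (κ l : Fin (d + 1)) (x' y' : Fin (d + 1) → ℤ) (p : Fin (d + 1) → ℂ) :
    kFibClosed Lc sf sm (j + 1) (Sum.inr κ) x' (Sum.inl l) y' p - kFibClosed Lc sf sm j (Sum.inr κ) x' (Sum.inl l) y' p =
      cphase (quo Lc x') p *
        (((sm (j + 1) * sf (j + 1) : ℝ) : ℂ) * phiSol (Lc ^ (j + 2)) p (fhatF (Lc ^ (j + 2)) (Lc ^ (j + 1)) p l y') 0 κ -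
          ((sm j * sf j : ℝ) : ℂ) * phiSol (Lc ^ (j + 1)) p (fhatF (Lc ^ (j + 1)) (Lc ^ j) p l y') 0 κ) := by
  show kFibClosedW _ _ _ _ _ _ _ _ p - kFibClosedW _ _ _ _ _ _ _ _ p = _
  rw [ClosedFormBoundOfParts.kFibClosedW_mf, ClosedFormBoundOfParts.kFibClosedW_mf, cphase_mf_step Lc (j + 1), cphase_mf_step Lc j]
  ring

/-- [folklore] **mm DIFFERENCE**: the common phase `e^{ip·(quo Lc x′ − quo Lc y′)}` factors out. -/
theorem kFibClosed_succ_sub_mm (κ l : Fin (d + 1)) (x' y' : Fin (d + 1) → ℤ) (p : Fin (d + 1) → ℂ) :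
    kFibClosed Lc sf sm (j + 1) (Sum.inr κ) x' (Sum.inr l) y' p - kFibClosed Lc sf sm j (Sum.inr κ) x' (Sum.inr l) y' p =
      cphase (quo Lc x' - quo Lc y') p *
        (((sm (j + 1) * sm (j + 1) : ℝ) : ℂ) * phiSol (Lc ^ (j + 2)) p 0 (eVec l) κ -
          ((sm j * sm j : ℝ) : ℂ) * phiSol (Lc ^ (j + 1)) p 0 (eVec l) κ) := by
  show kFibClosedW _ _ _ _ _ _ _ _ p - kFibClosedW _ _ _ _ _ _ _ _ p = _
  rw [ClosedFormBoundOfParts.kFibClosedW_mm, ClosedFormBoundOfParts.kFibClosedW_mm, cphase_mm_step Lc (j + 1), cphase_mm_step Lc j]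
  ring

/-- [folklore] **ff PLUG FORM** (item (iii)): matched-label rates `ρ m` of the unit-scaled summands against the LIFTED label and a tail
bound `τ` over the NEW labels give `‖Δ_ff‖ ≤ Σ_m ρ m + τ`, every complex `p`. -/
theorem norm_kFibClosed_succ_sub_ff_le (κ l : Fin (d + 1)) (x' y' : Fin (d + 1) → ℤ) (p : Fin (d + 1) → ℂ)
    (ρ : TorusSite (d + 1) (Lc ^ (j + 1)) → ℝ) {τ : ℝ}
    (hρ : ∀ m, ‖((sf (j + 1) * sf (j + 1) : ℝ) : ℂ) * (readW (Lc ^ (j + 2)) (Lc ^ (j + 1)) p (lift (Lc ^ (j + 2)) m) κ x' *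
          Ahat (Lc ^ (j + 2)) p (fhatF (Lc ^ (j + 2)) (Lc ^ (j + 1)) p l y') 0 (lift (Lc ^ (j + 2)) m) κ) -
        ((sf j * sf j : ℝ) : ℂ) * (readW (Lc ^ (j + 1)) (Lc ^ j) p m κ x' * Ahat (Lc ^ (j + 1)) p (fhatF (Lc ^ (j + 1)) (Lc ^ j) p l y') 0 m κ)‖
        ≤ ρ m)
    (hτ : ∑ m' ∈ newLabels (Lc ^ (j + 1)) (Lc ^ (j + 2)), ‖((sf (j + 1) * sf (j + 1) : ℝ) : ℂ) *
        (readW (Lc ^ (j + 2)) (Lc ^ (j + 1)) p m' κ x' * Ahat (Lc ^ (j + 2)) p (fhatF (Lc ^ (j + 2)) (Lc ^ (j + 1)) p l y') 0 m' κ)‖ ≤ τ) :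
    ‖kFibClosed Lc sf sm (j + 1) (Sum.inl κ) x' (Sum.inl l) y' p - kFibClosed Lc sf sm j (Sum.inl κ) x' (Sum.inl l) y' p‖ ≤
      ∑ m, ρ m + τ := by
  rw [kFibClosed_succ_sub_ff]
  exact norm_mul_sum_sub_mul_sum_le_of_rates (pow_step_le Lc j) _ _ _ _ ρ hρ hτ

/-- [folklore] **ff PLUG FORM, FACTORISED** (reading weight | unit-scaled response; §1): per-label rates `ρ_R`, `ρ_A` and bounds `β_R` (level `j`
reading weight), `β_A` (level `j+1` scaled response) give `ρ m = ρ_R m·β_A m + β_R m·ρ_A m`. -/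
theorem norm_kFibClosed_succ_sub_ff_le_of_factors (κ l : Fin (d + 1)) (x' y' : Fin (d + 1) → ℤ) (p : Fin (d + 1) → ℂ)
    (ρR ρA βR βA : TorusSite (d + 1) (Lc ^ (j + 1)) → ℝ) {τ : ℝ}
    (hR : ∀ m, ‖readW (Lc ^ (j + 2)) (Lc ^ (j + 1)) p (lift (Lc ^ (j + 2)) m) κ x' - readW (Lc ^ (j + 1)) (Lc ^ j) p m κ x'‖ ≤ ρR m)
    (hA : ∀ m, ‖((sf (j + 1) * sf (j + 1) : ℝ) : ℂ) * Ahat (Lc ^ (j + 2)) p (fhatF (Lc ^ (j + 2)) (Lc ^ (j + 1)) p l y') 0 (lift (Lc ^ (j + 2)) m) κ -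
        ((sf j * sf j : ℝ) : ℂ) * Ahat (Lc ^ (j + 1)) p (fhatF (Lc ^ (j + 1)) (Lc ^ j) p l y') 0 m κ‖ ≤ ρA m)
    (hβR : ∀ m, ‖readW (Lc ^ (j + 1)) (Lc ^ j) p m κ x'‖ ≤ βR m)
    (hβA : ∀ m, ‖((sf (j + 1) * sf (j + 1) : ℝ) : ℂ) * Ahat (Lc ^ (j + 2)) p (fhatF (Lc ^ (j + 2)) (Lc ^ (j + 1)) p l y') 0 (lift (Lc ^ (j + 2)) m) κ‖ ≤ βA m)
    (hτ : ∑ m' ∈ newLabels (Lc ^ (j + 1)) (Lc ^ (j + 2)), ‖((sf (j + 1) * sf (j + 1) : ℝ) : ℂ) *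
        (readW (Lc ^ (j + 2)) (Lc ^ (j + 1)) p m' κ x' * Ahat (Lc ^ (j + 2)) p (fhatF (Lc ^ (j + 2)) (Lc ^ (j + 1)) p l y') 0 m' κ)‖ ≤ τ) :
    ‖kFibClosed Lc sf sm (j + 1) (Sum.inl κ) x' (Sum.inl l) y' p - kFibClosed Lc sf sm j (Sum.inl κ) x' (Sum.inl l) y' p‖ ≤
      ∑ m, (ρR m * βA m + βR m * ρA m) + τ := by
  exact norm_kFibClosed_succ_sub_ff_le Lc sf sm j κ l x' y' p _
    (fun m => norm_smul_mul_sub_le_of_bounds (hβR m) (hβA m) (hR m) (hA m)) hτ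

/-- [folklore] **fm PLUG FORM**: `‖Δ_fm‖ ≤ ‖e^{−ip·quo Lc y′}‖·(Σ_m ρ m + τ)`, every complex `p`. -/
theorem norm_kFibClosed_succ_sub_fm_le (κ l : Fin (d + 1)) (x' y' : Fin (d + 1) → ℤ) (p : Fin (d + 1) → ℂ)
    (ρ : TorusSite (d + 1) (Lc ^ (j + 1)) → ℝ) {τ : ℝ}
    (hρ : ∀ m, ‖((sf (j + 1) * sm (j + 1) : ℝ) : ℂ) * (readW (Lc ^ (j + 2)) (Lc ^ (j + 1)) p (lift (Lc ^ (j + 2)) m) κ x' *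
          Ahat (Lc ^ (j + 2)) p 0 (eVec l) (lift (Lc ^ (j + 2)) m) κ) -
        ((sf j * sm j : ℝ) : ℂ) * (readW (Lc ^ (j + 1)) (Lc ^ j) p m κ x' * Ahat (Lc ^ (j + 1)) p 0 (eVec l) m κ)‖ ≤ ρ m)
    (hτ : ∑ m' ∈ newLabels (Lc ^ (j + 1)) (Lc ^ (j + 2)), ‖((sf (j + 1) * sm (j + 1) : ℝ) : ℂ) *
        (readW (Lc ^ (j + 2)) (Lc ^ (j + 1)) p m' κ x' * Ahat (Lc ^ (j + 2)) p 0 (eVec l) m' κ)‖ ≤ τ) :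
    ‖kFibClosed Lc sf sm (j + 1) (Sum.inl κ) x' (Sum.inr l) y' p - kFibClosed Lc sf sm j (Sum.inl κ) x' (Sum.inr l) y' p‖ ≤
      ‖cphase (-quo Lc y') p‖ * (∑ m, ρ m + τ) := by
  rw [kFibClosed_succ_sub_fm, norm_mul]
  exact mul_le_mul_of_nonneg_left (norm_mul_sum_sub_mul_sum_le_of_rates (pow_step_le Lc j) _ _ _ _ ρ hρ hτ) (norm_nonneg _)

/-- [folklore] **fm PLUG FORM, FACTORISED** (reading weight | unit-scaled constraint response). -/
theorem norm_kFibClosed_succ_sub_fm_le_of_factors (κ l : Fin (d + 1)) (x' y' : Fin (d + 1) → ℤ) (p : Fin (d + 1) → ℂ)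
    (ρR ρA βR βA : TorusSite (d + 1) (Lc ^ (j + 1)) → ℝ) {τ : ℝ}
    (hR : ∀ m, ‖readW (Lc ^ (j + 2)) (Lc ^ (j + 1)) p (lift (Lc ^ (j + 2)) m) κ x' - readW (Lc ^ (j + 1)) (Lc ^ j) p m κ x'‖ ≤ ρR m)
    (hA : ∀ m, ‖((sf (j + 1) * sm (j + 1) : ℝ) : ℂ) * Ahat (Lc ^ (j + 2)) p 0 (eVec l) (lift (Lc ^ (j + 2)) m) κ -
        ((sf j * sm j : ℝ) : ℂ) * Ahat (Lc ^ (j + 1)) p 0 (eVec l) m κ‖ ≤ ρA m)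
    (hβR : ∀ m, ‖readW (Lc ^ (j + 1)) (Lc ^ j) p m κ x'‖ ≤ βR m)
    (hβA : ∀ m, ‖((sf (j + 1) * sm (j + 1) : ℝ) : ℂ) * Ahat (Lc ^ (j + 2)) p 0 (eVec l) (lift (Lc ^ (j + 2)) m) κ‖ ≤ βA m)
    (hτ : ∑ m' ∈ newLabels (Lc ^ (j + 1)) (Lc ^ (j + 2)), ‖((sf (j + 1) * sm (j + 1) : ℝ) : ℂ) *
        (readW (Lc ^ (j + 2)) (Lc ^ (j + 1)) p m' κ x' * Ahat (Lc ^ (j + 2)) p 0 (eVec l) m' κ)‖ ≤ τ) :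
    ‖kFibClosed Lc sf sm (j + 1) (Sum.inl κ) x' (Sum.inr l) y' p - kFibClosed Lc sf sm j (Sum.inl κ) x' (Sum.inr l) y' p‖ ≤
      ‖cphase (-quo Lc y') p‖ * (∑ m, (ρR m * βA m + βR m * ρA m) + τ) := by
  exact norm_kFibClosed_succ_sub_fm_le Lc sf sm j κ l x' y' p _
    (fun m => norm_smul_mul_sub_le_of_bounds (hβR m) (hβA m) (hR m) (hA m)) hτ

/-- [folklore] **mf PLUG FORM**: a rate `ρ` of the unit-scaled multiplier response to a force gives `‖Δ_mf‖ ≤ ‖e^{ip·quo Lc x′}‖·ρ`. -/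
theorem norm_kFibClosed_succ_sub_mf_le (κ l : Fin (d + 1)) (x' y' : Fin (d + 1) → ℤ) (p : Fin (d + 1) → ℂ) {ρ : ℝ}
    (hφ : ‖((sm (j + 1) * sf (j + 1) : ℝ) : ℂ) * phiSol (Lc ^ (j + 2)) p (fhatF (Lc ^ (j + 2)) (Lc ^ (j + 1)) p l y') 0 κ -
        ((sm j * sf j : ℝ) : ℂ) * phiSol (Lc ^ (j + 1)) p (fhatF (Lc ^ (j + 1)) (Lc ^ j) p l y') 0 κ‖ ≤ ρ) :
    ‖kFibClosed Lc sf sm (j + 1) (Sum.inr κ) x' (Sum.inl l) y' p - kFibClosed Lc sf sm j (Sum.inr κ) x' (Sum.inl l) y' p‖ ≤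
      ‖cphase (quo Lc x') p‖ * ρ := by
  rw [kFibClosed_succ_sub_mf, norm_mul]
  exact mul_le_mul_of_nonneg_left hφ (norm_nonneg _)

/-- [folklore] **mm PLUG FORM**: a rate `ρ` of the unit-scaled multiplier response to a constraint gives `‖Δ_mm‖ ≤ ‖e^{ip·(quo x′ − quo y′)}‖·ρ`. -/
theorem norm_kFibClosed_succ_sub_mm_le (κ l : Fin (d + 1)) (x' y' : Fin (d + 1) → ℤ) (p : Fin (d + 1) → ℂ) {ρ : ℝ}
    (hφ : ‖((sm (j + 1) * sm (j + 1) : ℝ) : ℂ) * phiSol (Lc ^ (j + 2)) p 0 (eVec l) κ -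
        ((sm j * sm j : ℝ) : ℂ) * phiSol (Lc ^ (j + 1)) p 0 (eVec l) κ‖ ≤ ρ) :
    ‖kFibClosed Lc sf sm (j + 1) (Sum.inr κ) x' (Sum.inr l) y' p - kFibClosed Lc sf sm j (Sum.inr κ) x' (Sum.inr l) y' p‖ ≤
      ‖cphase (quo Lc x' - quo Lc y') p‖ * ρ := by
  rw [kFibClosed_succ_sub_mm, norm_mul]
  exact mul_le_mul_of_nonneg_left hφ (norm_nonneg _)

end Legs

/-! ## §4 Real zone: unimodular phases, and the uniform plug form over the four leg types -/

section Real

variable (Lc : ℕ) [NeZero Lc] (sf sm : ℕ → ℝ) (j : ℕ)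

/-- [folklore] **fm PLUG FORM at real momentum**: `‖Δ_fm‖ ≤ Σ_m ρ m + τ`. -/
theorem norm_kFibClosed_succ_sub_fm_le_real (κ l : Fin (d + 1)) (x' y' : Fin (d + 1) → ℤ) (q : Fin (d + 1) → ℝ)
    (ρ : TorusSite (d + 1) (Lc ^ (j + 1)) → ℝ) {τ : ℝ}
    (hρ : ∀ m, ‖((sf (j + 1) * sm (j + 1) : ℝ) : ℂ) * (readW (Lc ^ (j + 2)) (Lc ^ (j + 1)) (ofRealVec q) (lift (Lc ^ (j + 2)) m) κ x' *
          Ahat (Lc ^ (j + 2)) (ofRealVec q) 0 (eVec l) (lift (Lc ^ (j + 2)) m) κ) -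
        ((sf j * sm j : ℝ) : ℂ) * (readW (Lc ^ (j + 1)) (Lc ^ j) (ofRealVec q) m κ x' * Ahat (Lc ^ (j + 1)) (ofRealVec q) 0 (eVec l) m κ)‖ ≤ ρ m)
    (hτ : ∑ m' ∈ newLabels (Lc ^ (j + 1)) (Lc ^ (j + 2)), ‖((sf (j + 1) * sm (j + 1) : ℝ) : ℂ) *
        (readW (Lc ^ (j + 2)) (Lc ^ (j + 1)) (ofRealVec q) m' κ x' * Ahat (Lc ^ (j + 2)) (ofRealVec q) 0 (eVec l) m' κ)‖ ≤ τ) :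
    ‖kFibClosed Lc sf sm (j + 1) (Sum.inl κ) x' (Sum.inr l) y' (ofRealVec q) -
        kFibClosed Lc sf sm j (Sum.inl κ) x' (Sum.inr l) y' (ofRealVec q)‖ ≤ ∑ m, ρ m + τ := by
  have h := norm_kFibClosed_succ_sub_fm_le Lc sf sm j κ l x' y' (ofRealVec q) ρ hρ hτ
  rwa [norm_cphase_ofRealVec, one_mul] at h

/-- [folklore] **mf PLUG FORM at real momentum**: `‖Δ_mf‖ ≤ ρ`. -/
theorem norm_kFibClosed_succ_sub_mf_le_real (κ l : Fin (d + 1)) (x' y' : Fin (d + 1) → ℤ) (q : Fin (d + 1) → ℝ) {ρ : ℝ}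
    (hφ : ‖((sm (j + 1) * sf (j + 1) : ℝ) : ℂ) * phiSol (Lc ^ (j + 2)) (ofRealVec q) (fhatF (Lc ^ (j + 2)) (Lc ^ (j + 1)) (ofRealVec q) l y') 0 κ -
        ((sm j * sf j : ℝ) : ℂ) * phiSol (Lc ^ (j + 1)) (ofRealVec q) (fhatF (Lc ^ (j + 1)) (Lc ^ j) (ofRealVec q) l y') 0 κ‖ ≤ ρ) :
    ‖kFibClosed Lc sf sm (j + 1) (Sum.inr κ) x' (Sum.inl l) y' (ofRealVec q) -
        kFibClosed Lc sf sm j (Sum.inr κ) x' (Sum.inl l) y' (ofRealVec q)‖ ≤ ρ := by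
  have h := norm_kFibClosed_succ_sub_mf_le Lc sf sm j κ l x' y' (ofRealVec q) hφ
  rwa [norm_cphase_ofRealVec, one_mul] at h

/-- [folklore] **mm PLUG FORM at real momentum**: `‖Δ_mm‖ ≤ ρ`. -/
theorem norm_kFibClosed_succ_sub_mm_le_real (κ l : Fin (d + 1)) (x' y' : Fin (d + 1) → ℤ) (q : Fin (d + 1) → ℝ) {ρ : ℝ}
    (hφ : ‖((sm (j + 1) * sm (j + 1) : ℝ) : ℂ) * phiSol (Lc ^ (j + 2)) (ofRealVec q) 0 (eVec l) κ -
        ((sm j * sm j : ℝ) : ℂ) * phiSol (Lc ^ (j + 1)) (ofRealVec q) 0 (eVec l) κ‖ ≤ ρ) :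
    ‖kFibClosed Lc sf sm (j + 1) (Sum.inr κ) x' (Sum.inr l) y' (ofRealVec q) -
        kFibClosed Lc sf sm j (Sum.inr κ) x' (Sum.inr l) y' (ofRealVec q)‖ ≤ ρ := by
  have h := norm_kFibClosed_succ_sub_mm_le Lc sf sm j κ l x' y' (ofRealVec q) hφ
  rwa [norm_cphase_ofRealVec, one_mul] at h

/-- [folklore] **UNIFORM PLUG FORM FOR THE ONE-STEP DIFFERENCE** at real momentum `q`: if the assembled unit-scaled two-level differences of
the ff alias sums are `≤ C_ff`, of the fm alias sums `≤ C_fm`, of the multiplier responses to a force `≤ C_mf` and to a constraint `≤ C_mm`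
(all four nonnegative; rows Y11r/Y11s/N13/E3 supply them, p1 row L11 recognises `c·θ^j` in them), then for EVERY leg pair
`‖kFibClosed … (j+1) a x′ b y′ (ofRealVec q) − kFibClosed … j a x′ b y′ (ofRealVec q)‖ ≤ C_ff + C_fm + C_mf + C_mm`. -/
theorem norm_kFibClosed_succ_sub_le_of_parts (q : Fin (d + 1) → ℝ) {Cff Cfm Cmf Cmm : ℝ}
    (hCff : 0 ≤ Cff) (hCfm : 0 ≤ Cfm) (hCmf : 0 ≤ Cmf) (hCmm : 0 ≤ Cmm)
    (hff : ∀ κ l x' y', ‖((sf (j + 1) * sf (j + 1) : ℝ) : ℂ) * ∑ m', readW (Lc ^ (j + 2)) (Lc ^ (j + 1)) (ofRealVec q) m' κ x' *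
          Ahat (Lc ^ (j + 2)) (ofRealVec q) (fhatF (Lc ^ (j + 2)) (Lc ^ (j + 1)) (ofRealVec q) l y') 0 m' κ -
        ((sf j * sf j : ℝ) : ℂ) * ∑ m, readW (Lc ^ (j + 1)) (Lc ^ j) (ofRealVec q) m κ x' *
          Ahat (Lc ^ (j + 1)) (ofRealVec q) (fhatF (Lc ^ (j + 1)) (Lc ^ j) (ofRealVec q) l y') 0 m κ‖ ≤ Cff)
    (hfm : ∀ κ l x', ‖((sf (j + 1) * sm (j + 1) : ℝ) : ℂ) * ∑ m', readW (Lc ^ (j + 2)) (Lc ^ (j + 1)) (ofRealVec q) m' κ x' *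
          Ahat (Lc ^ (j + 2)) (ofRealVec q) 0 (eVec l) m' κ -
        ((sf j * sm j : ℝ) : ℂ) * ∑ m, readW (Lc ^ (j + 1)) (Lc ^ j) (ofRealVec q) m κ x' * Ahat (Lc ^ (j + 1)) (ofRealVec q) 0 (eVec l) m κ‖ ≤ Cfm)
    (hmf : ∀ κ l y', ‖((sm (j + 1) * sf (j + 1) : ℝ) : ℂ) * phiSol (Lc ^ (j + 2)) (ofRealVec q) (fhatF (Lc ^ (j + 2)) (Lc ^ (j + 1)) (ofRealVec q) l y') 0 κ -
        ((sm j * sf j : ℝ) : ℂ) * phiSol (Lc ^ (j + 1)) (ofRealVec q) (fhatF (Lc ^ (j + 1)) (Lc ^ j) (ofRealVec q) l y') 0 κ‖ ≤ Cmf)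
    (hmm : ∀ κ l, ‖((sm (j + 1) * sm (j + 1) : ℝ) : ℂ) * phiSol (Lc ^ (j + 2)) (ofRealVec q) 0 (eVec l) κ -
        ((sm j * sm j : ℝ) : ℂ) * phiSol (Lc ^ (j + 1)) (ofRealVec q) 0 (eVec l) κ‖ ≤ Cmm)
    (a : Fib d) (x' : Fin (d + 1) → ℤ) (b : Fib d) (y' : Fin (d + 1) → ℤ) :
    ‖kFibClosed Lc sf sm (j + 1) a x' b y' (ofRealVec q) - kFibClosed Lc sf sm j a x' b y' (ofRealVec q)‖ ≤ Cff + Cfm + Cmf + Cmm := by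
  rcases a with κ | κ <;> rcases b with l | l
  · rw [kFibClosed_succ_sub_ff]
    linarith [hff κ l x' y']
  · rw [kFibClosed_succ_sub_fm, norm_mul, norm_cphase_ofRealVec, one_mul]
    linarith [hfm κ l x']
  · rw [kFibClosed_succ_sub_mf, norm_mul, norm_cphase_ofRealVec, one_mul]
    linarith [hmf κ l y']
  · rw [kFibClosed_succ_sub_mm, norm_mul, norm_cphase_ofRealVec, one_mul]
    linarith [hmm κ l]

end Real

end Summit.QuantumFields.BalabanUV.Beta.GAN24.ClosedFormRateOfParts

end
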